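import Literature.AnabelianGeometry.SemiGraphs.TemperedCompactConfinedOverFinite
import Literature.AnabelianGeometry.SemiGraphs.ThetaRayEscape
import HarnessLib

/-!
# Escape of the fixed points of non-verticial compact subgroups of `π₁^temp(𝒢)` ([SemiAnbd] Thm 3.7 (iii))

Mochizuki, *Semi-graphs of anabelioids*, Publ. RIMS **42** (2006) [MochizukiSemiAnbd2006], §3, Theorem 3.7
(iii) pp. 40–41 ("Every compact subgroup of `π₁^temp(𝒢)` is contained in at least one verticial subgroup"),
proof p. 41 with the author's *Comments* (2020), item (6); the hypothesis "totally estranged" of Thm 3.7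
p. 40.

PROOF-ONLY file (abc-iut cell, layer L3, seat abc-iut-L3-d4 gen 7, row «B9-GENERAL-PAIR@𝒢_θ» step (GP-1) /
memo (S3); no definition, no named fact).  At a countable `𝒢` satisfying the hypotheses of Thm 3.7 whose
underlying semi-graph carries a HEIGHT `H` with the exact ±1 step along every edge and finite sub-level sets
(a ray, a line, … — the shape of the countermodel `𝒢_θ` of the cell's ∀-typing F-1732), the existence
sentence of Thm 3.7 (iii) can fail only through ESCAPING compact subgroups, and this file proves that it is
EXACTLY the dichotomy — for the tempered fundamental group of Prop. 3.6 (canonical chart, Galois tower of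
trees `𝔾̃_j`):

* `height_unbounded_of_forall_not_le_verticial` — **if a compact `C ≤ π₁^temp(𝒢)` lies in NO verticial
  subgroup, then for every `N` some level has every `C`-fixed vertex of `𝔾̃_j` at height `≥ N`** (the fixed
  points ESCAPE).  Proof: if a height `h` carried a `C`-fixed vertex at every level, then — the fixed points
  not being confined (`exists_fixed_vertex_not_over_of_forall_not_le`, p. 41 localised) — every level also
  carries one of height `≥ h + 2`, and the fixed geodesic between them a CRITICAL sub-joint at height `h + 1`
  (`SemiGraph.exists_critical_of_walk`, abc-iut-L3-t6): a `C`-fixed vertex with two `C`-fixed branches over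
  DIFFERENT branches of `𝔾`, over the finite set `{H ≤ h + 1}`; Kőnig (`exists_compatible_of_finite`) gives a
  compatible system of `C`-fixed branch-pairs of the finite levels, which total estrangement forbids unless
  `C = 1` ((I4′)_cpt `stabBranchPairCpt'_temperedPiChart`, `noFixedBranchPairSystem_of_isTotallyEstranged_cpt`);
* `exists_bounded_fixed_of_le_verticial` — conversely a subgroup of a verticial subgroup fixes vertices of one
  and the same height at every level ((I1) `fix_temperedPiChart`);
* `exists_verticial_ge_iff_bounded_fixed` — hence **a compact `C` lies in a verticial subgroup iff its fixed
  vertices have bounded height along the tower**;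
* `thetaRay_height_unbounded_of_forall_not_le_verticial`, `…_of_anchorFree`, `…_iff_bounded_fixed` — at
  every ray of groups `thetaRay G E up low` (`H = id`), in particular `𝒢_θ(p,n)`: every ANCHOR-FREE compact
  subgroup of `π₁^temp(𝒢_θ)` has escaping fixed points (memo B9 (S3), arbitrary anchor-free compacts).
Nothing of [SemiAnbd] is asserted beyond what is proved; nothing here bears on [IUTchIII] Cor. 3.12 (IUT uses
finite dual semi-graphs only); typed ≠ proved.
-/

namespace Literature.AnabelianGeometry.SemiGraphs

namespace ProfiniteSemiGraph

open CategoryTheory Topology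

universe u

variable (𝒢 : ProfiniteSemiGraph.{u}) (h37 : 𝒢.Thm37Hypotheses)

/-- **THE FIXED POINTS OF A NON-VERTICIAL COMPACT SUBGROUP ESCAPE** (see the module docstring): for a height
`H` on `𝔾` with the exact ±1 step along every edge and finite sub-level sets `{H ≤ n}` carrying finitely many
branches, a compact `C ≤ π₁^temp(𝒢)` (canonical chart) contained in no verticial subgroup has, for every `N`,
a level of the Galois tower at which all `C`-fixed tree vertices have height `≥ N`.
[cite: MochizukiSemiAnbd2006, Thm 3.7(iii) pp.40-41] -/
theorem height_unbounded_of_forall_not_le_verticial (H : 𝒢.graph.Vertex → ℕ)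
    (hstep : ∀ (b₁ b₂ : 𝒢.graph.Branch) (v₁ v₂ : 𝒢.graph.Vertex), b₁ ≠ b₂ →
      𝒢.graph.edgeOf b₁ = 𝒢.graph.edgeOf b₂ → 𝒢.graph.abuts b₁ = some v₁ → 𝒢.graph.abuts b₂ = some v₂ →
      H v₁ + 1 = H v₂ ∨ H v₂ + 1 = H v₁)
    (hfin : ∀ n : ℕ, Set.Finite {v : 𝒢.graph.Vertex | H v ≤ n})
    (hfinb : ∀ n : ℕ, Set.Finite {b : 𝒢.graph.Branch | ∃ v ∈ {v : 𝒢.graph.Vertex | H v ≤ n},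
      𝒢.graph.abuts b = some v})
    (C : Subgroup (𝒢.temperedPiChart h37.toProp36Hypotheses).G)
    (hC : IsCompact (C : Set (𝒢.temperedPiChart h37.toProp36Hypotheses).G))
    (hnot : ∀ (v : 𝒢.graph.Vertex) (K : Subgroup (𝒢.temperedPiChart h37.toProp36Hypotheses).G),
      K ∈ verticialSubgroups (𝒢.temperedPiChart h37.toProp36Hypotheses) v → ¬ C ≤ K) (N : ℕ) :
    ∃ j : ℕ, ∀ y : ((𝒢.galoisLevelData h37.toProp36Hypotheses).tree j).Vertex,
      (∀ g ∈ C, ((𝒢.galoisLevelData h37.toProp36Hypotheses).treeAct h37.isCountable j g).hom.vertexMap y = y) →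
        N ≤ H (((𝒢.galoisLevelData h37.toProp36Hypotheses).treeProj j).vertexMap y) := by
  classical
  have h36 : 𝒢.Prop36Hypotheses := h37.toProp36Hypotheses
  let Dg := 𝒢.galoisLevelData h36
  have hc := h36.isCountable
  let hconn := 𝒢.galoisLevelData_hconn h36
  have hC1 : C ≠ ⊥ := by
    intro hb
    obtain ⟨K, hK⟩ := (verticialInjective_holds 𝒢 h37 (𝒢.temperedPiChart h36) (𝒢.baseVertex h36)).1
    exact hnot _ K hK (by rw [hb]; exact bot_le)
  -- projections of fixed vertices are fixed, of the same height
  have hproj : ∀ {i i' : ℕ} (h : i ≤ i') (y : (Dg.tree i').Vertex),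
      (∀ g ∈ C, (Dg.treeAct hc i' g).hom.vertexMap y = y) →
      (∀ g ∈ C, (Dg.treeAct hc i g).hom.vertexMap ((Dg.treeTrans h).vertexMap y) = (Dg.treeTrans h).vertexMap y) ∧
        (Dg.treeProj i).vertexMap ((Dg.treeTrans h).vertexMap y) = (Dg.treeProj i').vertexMap y := by
    intro i i' h y hy
    refine ⟨fun g hg => ?_, ?_⟩
    · have e2 := congrArg (fun φ => SemiGraph.Hom.vertexMap φ y) (Dg.treeTrans_act hc h g)
      simp only [SemiGraph.comp_vertexMap, Function.comp_apply, hy g hg] at e2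
      exact e2.symm
    · have e := congrArg (fun φ => SemiGraph.Hom.vertexMap φ y) (Dg.treeTrans_over h)
      simpa only [SemiGraph.comp_vertexMap, Function.comp_apply] using e
  -- KEY: no height is hit by `C`-fixed vertices at every level
  have key : ∀ h : ℕ, ¬ ∀ j : ℕ, ∃ y : (Dg.tree j).Vertex,
      (∀ g ∈ C, (Dg.treeAct hc j g).hom.vertexMap y = y) ∧ H ((Dg.treeProj j).vertexMap y) = h := by
    intro h hall
    -- far fixed vertices at every level: the fixed points of `C` are not confined over `{H ≤ h + 1}`
    have hfar : ∀ j : ℕ, ∃ x : (Dg.tree j).Vertex, (∀ g ∈ C, (Dg.treeAct hc j g).hom.vertexMap x = x) ∧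
        h + 2 ≤ H ((Dg.treeProj j).vertexMap x) := by
      intro j
      obtain ⟨x, hx, hxF⟩ := 𝒢.exists_fixed_vertex_not_over_of_forall_not_le h37 {v | H v ≤ h + 1}
        (hfin _) (hfinb _) C hC hnot j
      refine ⟨x, hx, ?_⟩
      simp only [Set.mem_setOf_eq, not_le] at hxF
      exact hxF
    have hnobp := noFixedBranchPairSystem_of_isTotallyEstranged_cpt h37 (𝒢.temperedPiChart h36)
      (fun n => (Dg.S n).orbitGraph) (fun n => Dg.levelAct hc hconn n) (fun _ _ h => Dg.levelTrans h) C
      (𝒢.stabBranchPairCpt'_temperedPiChart h36 (galoisLevelData_faithfulV 𝒢 h37) C hC)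
    -- the Kőnig system: `C`-fixed branch-pairs of the finite levels over `{H ≤ h + 1}` lying over two
    -- DIFFERENT branches of `𝔾`
    let F : Set 𝒢.graph.Vertex := {v | H v ≤ h + 1}
    let X : ℕ → Type u := fun i =>
      (Dg.S i).orbitGraph.Vertex × (Dg.S i).orbitGraph.Branch × (Dg.S i).orbitGraph.Branch
    let A : ∀ i, Set (X i) := fun i => {t | (Dg.S i).orbitGraphProj.vertexMap t.1 ∈ F ∧
      (Dg.S i).orbitGraph.abuts t.2.1 = some t.1 ∧ (Dg.S i).orbitGraph.abuts t.2.2 = some t.1 ∧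
      (Dg.S i).orbitGraphProj.branchMap t.2.1 ≠ (Dg.S i).orbitGraphProj.branchMap t.2.2 ∧
      ∀ g ∈ C, (Dg.levelAct hc hconn i g).hom.vertexMap t.1 = t.1 ∧
        (Dg.levelAct hc hconn i g).hom.branchMap t.2.1 = t.2.1 ∧
        (Dg.levelAct hc hconn i g).hom.branchMap t.2.2 = t.2.2}
    let ff : ∀ ⦃i i' : ℕ⦄, i ≤ i' → X i' → X i := fun i i' hii t =>
      ((Dg.levelTrans hii).vertexMap t.1, (Dg.levelTrans hii).branchMap t.2.1, (Dg.levelTrans hii).branchMap t.2.2)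
    have ff_id : ∀ (i : ℕ) (x : X i), ff le_rfl x = x := by
      intro i x
      show ((Dg.levelTrans le_rfl).vertexMap x.1, (Dg.levelTrans le_rfl).branchMap x.2.1,
        (Dg.levelTrans le_rfl).branchMap x.2.2) = x
      rw [Dg.levelTrans_self]
      rfl
    have ff_comp : ∀ ⦃i i' i'' : ℕ⦄ (h1 : i ≤ i') (h2 : i' ≤ i'') (x : X i''),
        ff h1 (ff h2 x) = ff (h1.trans h2) x := by
      intro i i' i'' h1 h2 x
      simp only [ff, ← Dg.levelTrans_comp h1 h2, SemiGraph.comp_vertexMap, SemiGraph.comp_branchMap,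
        Function.comp_apply]
    have hbaseV : ∀ ⦃i i' : ℕ⦄ (hii : i ≤ i') (w : (Dg.S i').orbitGraph.Vertex),
        (Dg.S i).orbitGraphProj.vertexMap ((Dg.levelTrans hii).vertexMap w) = (Dg.S i').orbitGraphProj.vertexMap w := by
      intro i i' hii w
      have e := congrArg (fun φ => SemiGraph.Hom.vertexMap φ w) (Dg.levelTrans_proj hii)
      simpa only [SemiGraph.comp_vertexMap, Function.comp_apply] using e
    have hbaseB : ∀ ⦃i i' : ℕ⦄ (hii : i ≤ i') (β : (Dg.S i').orbitGraph.Branch),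
        (Dg.S i).orbitGraphProj.branchMap ((Dg.levelTrans hii).branchMap β) = (Dg.S i').orbitGraphProj.branchMap β := by
      intro i i' hii β
      have e := congrArg (fun φ => SemiGraph.Hom.branchMap φ β) (Dg.levelTrans_proj hii)
      simpa only [SemiGraph.comp_branchMap, Function.comp_apply] using e
    have eqV : ∀ ⦃i i' : ℕ⦄ (hii : i ≤ i') (g : (𝒢.temperedPiChart h36).G) (x : (Dg.S i').orbitGraph.Vertex),
        (Dg.levelAct hc hconn i g).hom.vertexMap ((Dg.levelTrans hii).vertexMap x) =
          (Dg.levelTrans hii).vertexMap ((Dg.levelAct hc hconn i' g).hom.vertexMap x) := by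
      intro i i' hii g x
      have := congrArg (fun ψ : (Dg.S i').orbitGraph ⟶ (Dg.S i).orbitGraph => ψ.vertexMap x)
        (Dg.levelTrans_act hc hconn hii g)
      exact this.symm
    have eqB : ∀ ⦃i i' : ℕ⦄ (hii : i ≤ i') (g : (𝒢.temperedPiChart h36).G) (b : (Dg.S i').orbitGraph.Branch),
        (Dg.levelAct hc hconn i g).hom.branchMap ((Dg.levelTrans hii).branchMap b) =
          (Dg.levelTrans hii).branchMap ((Dg.levelAct hc hconn i' g).hom.branchMap b) := by
      intro i i' hii g b
      have := congrArg (fun ψ : (Dg.S i').orbitGraph ⟶ (Dg.S i).orbitGraph => ψ.branchMap b)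
        (Dg.levelTrans_act hc hconn hii g)
      exact this.symm
    have hmap : ∀ ⦃i i' : ℕ⦄ (hii : i ≤ i') (x : X i'), x ∈ A i' → ff hii x ∈ A i := by
      rintro i i' hii ⟨w, β, β'⟩ ⟨hw, hβ, hβ', hne, hfix⟩
      refine ⟨?_, (Dg.levelTrans hii).abuts_branchMap _ _ hβ, (Dg.levelTrans hii).abuts_branchMap _ _ hβ', ?_,
        fun g hg => ⟨?_, ?_, ?_⟩⟩
      · show (Dg.S i).orbitGraphProj.vertexMap ((Dg.levelTrans hii).vertexMap w) ∈ F
        rw [hbaseV]; exact hw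
      · show (Dg.S i).orbitGraphProj.branchMap ((Dg.levelTrans hii).branchMap β) ≠
          (Dg.S i).orbitGraphProj.branchMap ((Dg.levelTrans hii).branchMap β')
        rw [hbaseB, hbaseB]; exact hne
      · show (Dg.levelAct hc hconn i g).hom.vertexMap ((Dg.levelTrans hii).vertexMap w) = (Dg.levelTrans hii).vertexMap w
        rw [eqV, (hfix g hg).1]
      · show (Dg.levelAct hc hconn i g).hom.branchMap ((Dg.levelTrans hii).branchMap β) = (Dg.levelTrans hii).branchMap β
        rw [eqB, (hfix g hg).2.1]
      · show (Dg.levelAct hc hconn i g).hom.branchMap ((Dg.levelTrans hii).branchMap β') = (Dg.levelTrans hii).branchMap β'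
        rw [eqB, (hfix g hg).2.2]
    have hfinA : ∀ i, (A i).Finite := fun i =>
      ((Dg.S i).finite_branchPairs_over (𝒢.galoisLevelData_isFinite h36 i) F (hfin _) (hfinb _)).subset
        fun t ht => ⟨ht.1, ht.2.1, ht.2.2.1⟩
    -- every `A_i` is nonempty: the critical sub-joint of the fixed geodesic from a far fixed vertex to a
    -- fixed vertex of height `h`, pushed down to the finite level
    have hne : ∀ i, (A i).Nonempty := by
      intro i
      obtain ⟨yv, hyfix, hyh⟩ := hall i
      obtain ⟨xv, hxfix, hxh⟩ := hfar i
      have hT := (Dg.isTree_tree i).isTree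
      -- the exact height step on the tree
      have hstepT : ∀ (b₁ b₂ : (Dg.tree i).Branch) (v₁ v₂ : (Dg.tree i).Vertex), b₁ ≠ b₂ →
          (Dg.tree i).edgeOf b₁ = (Dg.tree i).edgeOf b₂ → (Dg.tree i).abuts b₁ = some v₁ →
          (Dg.tree i).abuts b₂ = some v₂ →
          H ((Dg.treeProj i).vertexMap v₁) + 1 = H ((Dg.treeProj i).vertexMap v₂) ∨
            H ((Dg.treeProj i).vertexMap v₂) + 1 = H ((Dg.treeProj i).vertexMap v₁) := by
        intro b₁ b₂ v₁ v₂ hne he h₁ h₂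
        refine hstep ((Dg.treeProj i).branchMap b₁) ((Dg.treeProj i).branchMap b₂) _ _ ?_ ?_
          ((Dg.treeProj i).abuts_branchMap b₁ v₁ h₁) ((Dg.treeProj i).abuts_branchMap b₂ v₂ h₂)
        · exact fun hh => hne ((Dg.treeProj i).branchMap_injOn b₁ b₂ he hh)
        · rw [(Dg.treeProj i).edgeOf_branchMap, (Dg.treeProj i).edgeOf_branchMap, he]
      let pth : (Dg.tree i).subdivision.Path (Sum.inl xv) (Sum.inl yv) :=
        (hT.connected (Sum.inl xv) (Sum.inl yv)).some.toPath
      have hallfix : ∀ z ∈ pth.1.support, ∀ g ∈ C, SemiGraph.nodeMap (Dg.treeAct hc i g) z = z :=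
        fun z hz g hg => SemiGraph.nodeMap_eq_self_of_isPath hT.isAcyclic (Dg.treeAct hc i g)
          (by rw [SemiGraph.nodeMap_inl, hxfix g hg]) (by rw [SemiGraph.nodeMap_inl, hyfix g hg]) pth.1 pth.2 z hz
      obtain ⟨v, b, b', hb, hb', hv, hPb, hPb', hup, hdown⟩ :=
        (Dg.tree i).exists_critical_of_walk (fun w => H ((Dg.treeProj i).vertexMap w)) hstepT
          (fun z => ∀ g ∈ C, SemiGraph.nodeMap (Dg.treeAct hc i g) z = z) h hxh (le_of_eq hyh) pth.1 hallfix
      -- the two edges, branches and the vertex are `C`-fixed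
      have he : ∀ g ∈ C, (Dg.treeAct hc i g).hom.edgeMap ((Dg.tree i).edgeOf b) = (Dg.tree i).edgeOf b :=
        fun g hg => by simpa using hPb g hg
      have he' : ∀ g ∈ C, (Dg.treeAct hc i g).hom.edgeMap ((Dg.tree i).edgeOf b') = (Dg.tree i).edgeOf b' :=
        fun g hg => by simpa using hPb' g hg
      have hbfix : ∀ g ∈ C, (Dg.treeAct hc i g).hom.branchMap b = b := fun g hg =>
        SemiGraph.branchMap_eq_of_over_aut (Dg.treeProj i) (Dg.treeAct hc i g) (Dg.treeAct_over hc i g) b (he g hg)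
      have hb'fix : ∀ g ∈ C, (Dg.treeAct hc i g).hom.branchMap b' = b' := fun g hg =>
        SemiGraph.branchMap_eq_of_over_aut (Dg.treeProj i) (Dg.treeAct hc i g) (Dg.treeAct_over hc i g) b' (he' g hg)
      have hvfix : ∀ g ∈ C, (Dg.treeAct hc i g).hom.vertexMap v = v := by
        intro g hg
        have h1 := (Dg.treeAct hc i g).hom.abuts_branchMap b v hb
        rw [hbfix g hg, hb] at h1
        exact (Option.some.inj h1).symm
      -- the two base branches differ (their edges reach heights `h + 2` and `h`)
      have hpb : (Dg.treeProj i).branchMap b ≠ (Dg.treeProj i).branchMap b' := by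
        intro heq
        obtain ⟨b₂, v₂, hb₂b, hb₂e, hb₂v, hv₂⟩ := hup
        obtain ⟨b₂', v₂', hb₂b', hb₂e', hb₂v', hv₂'⟩ := hdown
        set π := Dg.treeProj i with hπ
        have hne₂ : π.branchMap b₂ ≠ π.branchMap b := fun hh => hb₂b (π.branchMap_injOn b₂ b hb₂e hh)
        have hne₂' : π.branchMap b₂' ≠ π.branchMap b := fun hh =>
          hb₂b' (π.branchMap_injOn b₂' b' hb₂e' (hh.trans heq))
        obtain ⟨c₁, c₂, -, -, -, hall2⟩ := 𝒢.graph.two_branches (𝒢.graph.edgeOf (π.branchMap b))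
        have mb : π.branchMap b = c₁ ∨ π.branchMap b = c₂ := hall2 _ rfl
        have mb₂ : π.branchMap b₂ = c₁ ∨ π.branchMap b₂ = c₂ :=
          hall2 _ (by rw [π.edgeOf_branchMap, π.edgeOf_branchMap, hb₂e])
        have mb₂' : π.branchMap b₂' = c₁ ∨ π.branchMap b₂' = c₂ :=
          hall2 _ (by rw [π.edgeOf_branchMap, π.edgeOf_branchMap, hb₂e', ← π.edgeOf_branchMap b',
            ← π.edgeOf_branchMap b, heq])
        have hbb : π.branchMap b₂ = π.branchMap b₂' := by
          rcases mb with h1 | h1 <;> rcases mb₂ with h2 | h2 <;> rcases mb₂' with h3 | h3 <;>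
            first | exact h2.trans h3.symm | exact absurd (h2.trans h1.symm) hne₂ |
              exact absurd (h3.trans h1.symm) hne₂'
        have a₂ := π.abuts_branchMap b₂ v₂ hb₂v
        have a₂' := π.abuts_branchMap b₂' v₂' hb₂v'
        rw [hbb, a₂'] at a₂
        have hvv : π.vertexMap v₂' = π.vertexMap v₂ := Option.some.inj a₂
        have : H (π.vertexMap v₂') = H (π.vertexMap v₂) := by rw [hvv]
        omega
      let q := Dg.treeQuot i
      have hqV : ∀ g ∈ C, (Dg.levelAct hc hconn i g).hom.vertexMap (q.vertexMap v) = q.vertexMap v := by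
        intro g hg
        have e := congrArg (fun φ => SemiGraph.Hom.vertexMap φ v) (Dg.treeQuot_act hc hconn i g)
        simp only [SemiGraph.comp_vertexMap, Function.comp_apply, hvfix g hg] at e
        exact e.symm
      have hqB : ∀ g ∈ C, ∀ bb : (Dg.tree i).Branch, (Dg.treeAct hc i g).hom.branchMap bb = bb →
          (Dg.levelAct hc hconn i g).hom.branchMap (q.branchMap bb) = q.branchMap bb := by
        intro g hg bb hbb
        have e := congrArg (fun φ => SemiGraph.Hom.branchMap φ bb) (Dg.treeQuot_act hc hconn i g)
        simp only [SemiGraph.comp_branchMap, Function.comp_apply, hbb] at e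
        exact e.symm
      refine ⟨(q.vertexMap v, q.branchMap b, q.branchMap b'), ?_, q.abuts_branchMap b v hb,
        q.abuts_branchMap b' v hb', ?_, fun g hg => ⟨hqV g hg, hqB g hg b (hbfix g hg), hqB g hg b' (hb'fix g hg)⟩⟩
      · show H ((Dg.S i).orbitGraphProj.vertexMap ((Dg.treeQuot i).vertexMap v)) ≤ h + 1
        change H ((Dg.treeProj i).vertexMap v) ≤ h + 1
        omega
      · show (Dg.S i).orbitGraphProj.branchMap ((Dg.treeQuot i).branchMap b) ≠
          (Dg.S i).orbitGraphProj.branchMap ((Dg.treeQuot i).branchMap b')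
        exact hpb
    obtain ⟨x, hxA, hxc⟩ := SemiGraph.exists_compatible_of_finite ff ff_id ff_comp A hfinA hne hmap
    -- the compatible system of fixed branch-pairs forces `C = 1`
    refine hC1 (hnobp 0 (fun i => (x i.1).1) (fun i => (x i.1).2.1) (fun i => (x i.1).2.2)
      (fun i => ⟨fun heq => (hxA i.1).2.2.2.1 (congrArg _ heq), (hxA i.1).2.1, (hxA i.1).2.2.1⟩)
      (fun i i' hii => ?_) (fun i γ => (hxA i.1).2.2.2.2 γ.1 γ.2))
    have := hxc (show i.1 ≤ i'.1 from hii)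
    exact ⟨congrArg Prod.fst this, congrArg (fun t => t.2.1) this, congrArg (fun t => t.2.2) this⟩
  -- CONCLUSION: every height `< N` is eventually free of `C`-fixed vertices
  have hlow : ∀ h : ℕ, ∃ j₀ : ℕ, ∀ j, j₀ ≤ j → ∀ y : (Dg.tree j).Vertex,
      (∀ g ∈ C, (Dg.treeAct hc j g).hom.vertexMap y = y) → H ((Dg.treeProj j).vertexMap y) ≠ h := by
    intro h
    by_contra hh
    push Not at hh
    refine key h fun j => ?_
    obtain ⟨j', hjj', y, hy, hyh⟩ := hh j
    obtain ⟨hfix, hht⟩ := hproj hjj' y hy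
    exact ⟨(Dg.treeTrans hjj').vertexMap y, hfix, by rw [hht]; exact hyh⟩
  choose j₀ hj₀ using hlow
  obtain ⟨j, hj⟩ := Finset.exists_le ((Finset.range N).image j₀)
  refine ⟨j, fun y hy => ?_⟩
  by_contra hlt
  push Not at hlt
  exact hj₀ _ j (hj _ (Finset.mem_image_of_mem j₀ (Finset.mem_range.mpr hlt))) y hy rfl

/-- **Converse**: a subgroup of a verticial subgroup fixes, at every level, a tree vertex of one and the same
height (the compatible vertex system of (I1) `fix_temperedPiChart`, whose members all lie over one vertex of
`𝔾`). [cite: MochizukiSemiAnbd2006, Thm 3.7(iii) p.41] -/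
theorem exists_bounded_fixed_of_le_verticial (H : 𝒢.graph.Vertex → ℕ)
    (C : Subgroup (𝒢.temperedPiChart h37.toProp36Hypotheses).G)
    {v : 𝒢.graph.Vertex} {K : Subgroup (𝒢.temperedPiChart h37.toProp36Hypotheses).G}
    (hK : K ∈ verticialSubgroups (𝒢.temperedPiChart h37.toProp36Hypotheses) v) (hCK : C ≤ K) :
    ∃ N : ℕ, ∀ j : ℕ, ∃ y : ((𝒢.galoisLevelData h37.toProp36Hypotheses).tree j).Vertex,
      (∀ g ∈ C, ((𝒢.galoisLevelData h37.toProp36Hypotheses).treeAct h37.isCountable j g).hom.vertexMap y = y) ∧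
        H (((𝒢.galoisLevelData h37.toProp36Hypotheses).treeProj j).vertexMap y) < N := by
  obtain ⟨x, hxc, hxfix⟩ := fix_temperedPiChart (h36 := h37.toProp36Hypotheses) v K hK
  refine ⟨H (((𝒢.galoisLevelData h37.toProp36Hypotheses).treeProj 0).vertexMap (x 0)) + 1,
    fun j => ⟨x j, fun g hg => hxfix g (hCK hg) j, ?_⟩⟩
  have e := congrArg (fun φ => SemiGraph.Hom.vertexMap φ (x j))
    ((𝒢.galoisLevelData h37.toProp36Hypotheses).treeTrans_over (Nat.zero_le j))
  simp only [SemiGraph.comp_vertexMap, Function.comp_apply] at e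
  rw [hxc (Nat.zero_le j)] at e
  rw [← e]
  exact Nat.lt_succ_self _

/-- **THE DICHOTOMY**: under the hypotheses of `height_unbounded_of_forall_not_le_verticial`, a compact
`C ≤ π₁^temp(𝒢)` lies in a verticial subgroup IF AND ONLY IF its fixed tree vertices have bounded height along
the Galois tower (some height bound `N` such that every level carries a `C`-fixed vertex of height `< N`).
[cite: MochizukiSemiAnbd2006, Thm 3.7(iii) pp.40-41] -/
theorem exists_verticial_ge_iff_bounded_fixed (H : 𝒢.graph.Vertex → ℕ)
    (hstep : ∀ (b₁ b₂ : 𝒢.graph.Branch) (v₁ v₂ : 𝒢.graph.Vertex), b₁ ≠ b₂ →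
      𝒢.graph.edgeOf b₁ = 𝒢.graph.edgeOf b₂ → 𝒢.graph.abuts b₁ = some v₁ → 𝒢.graph.abuts b₂ = some v₂ →
      H v₁ + 1 = H v₂ ∨ H v₂ + 1 = H v₁)
    (hfin : ∀ n : ℕ, Set.Finite {v : 𝒢.graph.Vertex | H v ≤ n})
    (hfinb : ∀ n : ℕ, Set.Finite {b : 𝒢.graph.Branch | ∃ v ∈ {v : 𝒢.graph.Vertex | H v ≤ n},
      𝒢.graph.abuts b = some v})
    (C : Subgroup (𝒢.temperedPiChart h37.toProp36Hypotheses).G)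
    (hC : IsCompact (C : Set (𝒢.temperedPiChart h37.toProp36Hypotheses).G)) :
    (∃ (v : 𝒢.graph.Vertex) (K : Subgroup (𝒢.temperedPiChart h37.toProp36Hypotheses).G),
        K ∈ verticialSubgroups (𝒢.temperedPiChart h37.toProp36Hypotheses) v ∧ C ≤ K) ↔
      ∃ N : ℕ, ∀ j : ℕ, ∃ y : ((𝒢.galoisLevelData h37.toProp36Hypotheses).tree j).Vertex,
        (∀ g ∈ C, ((𝒢.galoisLevelData h37.toProp36Hypotheses).treeAct h37.isCountable j g).hom.vertexMap y = y) ∧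
          H (((𝒢.galoisLevelData h37.toProp36Hypotheses).treeProj j).vertexMap y) < N := by
  constructor
  · rintro ⟨v, K, hK, hCK⟩
    exact 𝒢.exists_bounded_fixed_of_le_verticial h37 H C hK hCK
  · rintro ⟨N, hN⟩
    by_contra hno
    push Not at hno
    obtain ⟨j, hj⟩ := 𝒢.height_unbounded_of_forall_not_le_verticial h37 H hstep hfin hfinb C hC
      (fun v K hK hCK => hno v K hK hCK) N
    obtain ⟨y, hy, hlt⟩ := hN j
    exact absurd (hj y hy) (not_le.mpr hlt)

/-! ### The ray of groups `thetaRay G E up low` (base the ray, height = the vertex itself) -/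

section Ray

variable {G E : Type} [Group G] [TopologicalSpace G] [IsTopologicalGroup G] [CompactSpace G]
  [TotallyDisconnectedSpace G] [Group E] [TopologicalSpace E] [IsTopologicalGroup E] [CompactSpace E]
  [TotallyDisconnectedSpace E] {up : E →ₜ* G} {low : ℕ → (E →ₜ* G)}

/-- **At a ray of groups the fixed points of a non-verticial compact subgroup escape**: for
`𝒢 = thetaRay G E up low` under the hypotheses of Thm 3.7 and a compact `C ≤ π₁^temp(𝒢)` (canonical chart)
lying in no verticial subgroup, for every `N` some level of the Galois tower has all `C`-fixed tree vertices
over vertices `≥ N` of the ray. [cite: MochizukiSemiAnbd2006, Thm 3.7(iii) pp.40-41] -/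
theorem thetaRay_height_unbounded_of_forall_not_le_verticial (h37 : (thetaRay G E up low).Thm37Hypotheses)
    (C : Subgroup ((thetaRay G E up low).temperedPiChart h37.toProp36Hypotheses).G)
    (hC : IsCompact (C : Set ((thetaRay G E up low).temperedPiChart h37.toProp36Hypotheses).G))
    (hnot : ∀ (v : ℕ) (K : Subgroup ((thetaRay G E up low).temperedPiChart h37.toProp36Hypotheses).G),
      K ∈ verticialSubgroups ((thetaRay G E up low).temperedPiChart h37.toProp36Hypotheses) v → ¬ C ≤ K)
    (N : ℕ) :
    ∃ j : ℕ, ∀ y : (((thetaRay G E up low).galoisLevelData h37.toProp36Hypotheses).tree j).Vertex,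
      (∀ g ∈ C, (((thetaRay G E up low).galoisLevelData h37.toProp36Hypotheses).treeAct h37.isCountable j
        g).hom.vertexMap y = y) →
        N ≤ (((thetaRay G E up low).galoisLevelData h37.toProp36Hypotheses).treeProj j).vertexMap y :=
  (thetaRay G E up low).height_unbounded_of_forall_not_le_verticial h37 (fun v : ℕ => v)
    SemiGraph.ray_heightStep (fun n => Set.finite_le_nat n)
    (fun n => finite_branches_over_of_isLocallyFinite (𝒢 := thetaRay G E up low) SemiGraph.ray_isLocallyFinite
      {v : ℕ | v ≤ n} (Set.finite_le_nat n))
    C hC hnot N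

/-- **Anchor-free compact subgroups of `π₁^temp` of a ray of groups (e.g. of `𝒢_θ`) have escaping fixed
points** (memo B9 (S3), for ARBITRARY anchor-free compacts): a nontrivial compact `C` meeting every verticial
subgroup trivially has, for every `N`, a level at which all its fixed tree vertices lie over vertices `≥ N`.
[cite: MochizukiSemiAnbd2006, Thm 3.7(iii) pp.40-41] -/
theorem thetaRay_height_unbounded_of_anchorFree (h37 : (thetaRay G E up low).Thm37Hypotheses)
    (C : Subgroup ((thetaRay G E up low).temperedPiChart h37.toProp36Hypotheses).G)
    (hC : IsCompact (C : Set ((thetaRay G E up low).temperedPiChart h37.toProp36Hypotheses).G)) (hC1 : C ≠ ⊥)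
    (hfree : ∀ (v : ℕ) (K : Subgroup ((thetaRay G E up low).temperedPiChart h37.toProp36Hypotheses).G),
      K ∈ verticialSubgroups ((thetaRay G E up low).temperedPiChart h37.toProp36Hypotheses) v → C ⊓ K = ⊥)
    (N : ℕ) :
    ∃ j : ℕ, ∀ y : (((thetaRay G E up low).galoisLevelData h37.toProp36Hypotheses).tree j).Vertex,
      (∀ g ∈ C, (((thetaRay G E up low).galoisLevelData h37.toProp36Hypotheses).treeAct h37.isCountable j
        g).hom.vertexMap y = y) →
        N ≤ (((thetaRay G E up low).galoisLevelData h37.toProp36Hypotheses).treeProj j).vertexMap y :=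
  thetaRay_height_unbounded_of_forall_not_le_verticial h37 C hC
    (fun v K hK hCK => hC1 (by rw [← inf_eq_left.mpr hCK]; exact hfree v K hK)) N

/-- **The dichotomy at a ray of groups**: a compact `C ≤ π₁^temp(thetaRay G E up low)` lies in a verticial
subgroup iff its fixed tree vertices stay below some height at every level. [cite: MochizukiSemiAnbd2006, Thm 3.7(iii) pp.40-41] -/
theorem thetaRay_exists_verticial_ge_iff_bounded_fixed (h37 : (thetaRay G E up low).Thm37Hypotheses)
    (C : Subgroup ((thetaRay G E up low).temperedPiChart h37.toProp36Hypotheses).G)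
    (hC : IsCompact (C : Set ((thetaRay G E up low).temperedPiChart h37.toProp36Hypotheses).G)) :
    (∃ (v : ℕ) (K : Subgroup ((thetaRay G E up low).temperedPiChart h37.toProp36Hypotheses).G),
        K ∈ verticialSubgroups ((thetaRay G E up low).temperedPiChart h37.toProp36Hypotheses) v ∧ C ≤ K) ↔
      ∃ N : ℕ, ∀ j : ℕ, ∃ y : (((thetaRay G E up low).galoisLevelData h37.toProp36Hypotheses).tree j).Vertex,
        (∀ g ∈ C, (((thetaRay G E up low).galoisLevelData h37.toProp36Hypotheses).treeAct h37.isCountable j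
          g).hom.vertexMap y = y) ∧
          (fun v : ℕ => v) ((((thetaRay G E up low).galoisLevelData h37.toProp36Hypotheses).treeProj j).vertexMap y)
            < N :=
  (thetaRay G E up low).exists_verticial_ge_iff_bounded_fixed h37 (fun v : ℕ => v) SemiGraph.ray_heightStep
    (fun n => Set.finite_le_nat n)
    (fun n => finite_branches_over_of_isLocallyFinite (𝒢 := thetaRay G E up low) SemiGraph.ray_isLocallyFinite
      {v : ℕ | v ≤ n} (Set.finite_le_nat n)) C hC

end Ray

end ProfiniteSemiGraph

end Literature.AnabelianGeometry.SemiGraphs
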